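import Literature.NumberTheory.LFunctions.MauduitRivatTypeIIS4Diag
import Literature.NumberTheory.LFunctions.MauduitRivatWindowCountSharp
import HarnessLib

/-!
# Mauduit–Rivat's type-II sums: the off-diagonal term `S₄''(r,s)` ((85); proved)

Everything in this file is PROVED. It bounds the contribution `corrS4rOff` of the frequencies
`h₀ + h₁ ≠ 0` to `S₄(r,s)` in §6.4.2 of C. Mauduit, J. Rivat, *Prime numbers along Rudin–Shapiro
sequences*, J. Eur. Math. Soc. 17 (2015) (matrix form: C. Müllner, Duke Math. J. 166 (2017),
§5.4.2), following the printed argument: sum the geometric progression in `m` (resp. in `n`),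
apply Lemma 4 along the arithmetic progression `(h₀+h₁)n + h₁r (mod k^{μ₂})`, bound the two
`(h₂, h₃)`-sums of `‖ĝ(h₂)ᴴ ĝ(h₀+h₂)‖` by `d` (Cauchy–Schwarz and Parseval (81)) and the weights by
`∑_{|h|<H} |â(h)| ≤ L/K + 1 + log H`:

* `sum_Ico_geomBound_linear_le` — `∑_{M₀≤m<M₁} min(V, 1/(2‖(am+b)/K‖)) ≤ (M₁/K+1)(2(a,K)V + K(1+log K))`
  for `a ∈ ℤ` (Lemma 4 on each period);
* `norm_phaseNM_le_m` / `norm_phaseNM_le_n` — the phase sum after summing `m` (resp. `n`) first;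
* `sum_norm_conjTranspose_mul_shift_le` — `∑_{h<K'} ‖ĝ(h)ᴴ ĝ(a+h)‖ ≤ d`;
* `sum_norm_ahat_le` — `∑_{|h|<H} |â(h)| ≤ L/K + 1 + log H` (`2H ≤ K`);
* `norm_innerH_le_of_phase_bound`, `norm_corrS4rOff_le_of_phase_bound` — the skeleton of (85);
* **`norm_corrS4rOff_le_m`** — MR (85) before the choice of parameters:
  `|S₄''(r,s)| ≤ K'² (L/K + 1 + log H)² d² (N₁/K + 1)(4H(M₁−M₀) + K(1+log K))`;
* **`norm_corrS4rOff_le_n`** — the same with the roles of `m` and `n` exchanged: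
  `|S₄''(r,s)| ≤ K'² (L/K + 1 + log H)² d² (M₁/K + 1)(4H(N₁−N₀) + K(1+log K))`
  (needed when the Cauchy–Schwarz variable `m` is the longer one).

Here `K = k^{μ₂}`, `L = k^{μ₀}`, `K' = k^{μ₂−μ₀}`, `H = Hs`.

## References
* C. Mauduit, J. Rivat, J. Eur. Math. Soc. 17 (2015), §6.4.2, (85). [MauduitRivat2015]
* C. Müllner, Duke Math. J. 166 (2017) = arXiv:1602.03042, §5.4.2. [Mullner2017]
-/

noncomputable section

open Finset Complex Matrix

open scoped FourierTransform InnerProductSpace ComplexConjugate Matrix.Norms.Frobenius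

namespace Literature.NumberTheory.LFunctions.MauduitRivat

open Literature.NumberTheory.Sieve.Vinogradov (geomBound geomBound_nonneg geomBound_neg geomBound_le
  geomBound_mono)
open Literature.NumberTheory.LFunctions.VinogradovZetaSum (geomBound_add_int)

variable {d : Type*} [Fintype d] [DecidableEq d] {G : Type*} [Group G]

/-! ## Lemma 4 along an arithmetic progression with integer difference -/

/-- **Lemma 4 along `am + b`**: for `a ∈ ℤ`, `b ∈ ℝ`, `K ≥ 1`, `V ≥ 0`,
`∑_{M₀≤m<M₁} min(V, 1/(2‖(am+b)/K‖)) ≤ (M₁/K + 1)(2 gcd(|a|,K) V + K(1 + log K))`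
(complete to `M₁/K + 1` periods; Lemma 4 on each). [cite: MauduitRivat2015, Lemma 4 and (21)] -/
theorem sum_Ico_geomBound_linear_le {K : ℕ} (hK : 0 < K) (a : ℤ) (b : ℝ) (M₀ M₁ : ℕ) {V : ℝ}
    (hV : 0 ≤ V) :
    ∑ m ∈ Ico M₀ M₁, geomBound V (((a : ℝ) * m + b) / K) ≤
      ((M₁ / K + 1 : ℕ) : ℝ) * (2 * (Nat.gcd a.natAbs K) * V + K * (1 + Real.log K)) := by
  have hKR : (K : ℝ) ≠ 0 := by exact_mod_cast hK.ne'
  -- reduce to `a ≥ 0` by `geomBound V (−x) = geomBound V x`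
  obtain ⟨b', hb'⟩ : ∃ b' : ℝ, ∀ m : ℕ, geomBound V (((a : ℝ) * m + b) / K) =
      geomBound V ((((a.natAbs : ℕ) : ℝ) * m + b') / K) := by
    rcases Int.natAbs_eq a with h | h
    · refine ⟨b, fun m => ?_⟩
      rw [Nat.cast_natAbs, Int.cast_abs,
        abs_of_nonneg (by exact_mod_cast (show (0 : ℤ) ≤ a by omega) : (0 : ℝ) ≤ (a : ℝ))]
    · refine ⟨-b, fun m => ?_⟩
      rw [← geomBound_neg]
      congr 1
      have ha : (a : ℝ) = -((a.natAbs : ℕ) : ℝ) := by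
        rw [Nat.cast_natAbs, Int.cast_abs]
        have : a ≤ 0 := by omega
        rw [abs_of_nonpos (by exact_mod_cast this)]
        ring
      rw [ha]; ring
  simp only [hb']
  set n := a.natAbs with hn
  set P := M₁ / K + 1 with hP
  have hper : ∀ m : ℕ, geomBound V (((n : ℝ) * ((m + K : ℕ) : ℝ) + b') / K) =
      geomBound V (((n : ℝ) * m + b') / K) := by
    intro m
    have e : ((n : ℝ) * ((m + K : ℕ) : ℝ) + b') / K = ((n : ℝ) * m + b') / K + ((n : ℤ) : ℝ) := by
      push_cast; field_simp; ring
    rw [e, geomBound_add_int]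
  have hsub : Ico M₀ M₁ ⊆ range (K * P) := by
    intro m hm
    rw [mem_Ico] at hm
    rw [mem_range, hP, Nat.mul_succ]
    have := Nat.lt_mul_div_succ M₁ hK
    have h2 : K * (M₁ / K + 1) = K * (M₁ / K) + K := by ring
    omega
  calc ∑ m ∈ Ico M₀ M₁, geomBound V (((n : ℝ) * m + b') / K)
      ≤ ∑ m ∈ range (K * P), geomBound V (((n : ℝ) * m + b') / K) :=
        sum_le_sum_of_subset_of_nonneg hsub fun m _ _ => geomBound_nonneg hV _
    _ = P * ∑ m ∈ range K, geomBound V (((n : ℝ) * m + b') / K) :=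
        sum_range_mul_of_periodic (P := K) (g := P)
          (h := fun m => geomBound V (((n : ℝ) * m + b') / K)) hper
    _ ≤ P * (2 * (Nat.gcd n K) * V + K * (1 + Real.log K)) := by
        gcongr
        exact sum_range_geomBound_progression_le hK n b' hV

/-- `gcd(|a|, K) ≤ A` when `0 < |a| ≤ A`. [folklore] -/
theorem gcd_natAbs_le {a : ℤ} {A K : ℕ} (ha : a ≠ 0) (hA : a.natAbs ≤ A) :
    (Nat.gcd a.natAbs K : ℝ) ≤ A := by
  have h := Nat.gcd_le_left K (Int.natAbs_pos.2 ha)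
  exact_mod_cast h.trans hA

/-! ## The phase sum, `m` or `n` summed first -/

/-- **Summing `m` first**: `‖phaseNM(h₀,h₁,h₂,h₃)‖ ≤ ∑_{N₀≤n<N₁} min(M₁−M₀, 1/(2‖((h₀+h₁)n + h₁r)/k^{μ₂}‖))`
(the two `K'`-phases do not depend on `m`). [cite: MauduitRivat2015, §6.4.2 (first display)] -/
theorem norm_phaseNM_le_m (k μ₀ μ₁ μ₂ M₀ M₁ N₀ N₁ r s : ℕ) (h₀ h₁ : ℤ) (h₂ h₃ : ℕ) :
    ‖phaseNM k μ₀ μ₁ μ₂ M₀ M₁ N₀ N₁ r s h₀ h₁ h₂ h₃‖ ≤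
      ∑ n ∈ Ico N₀ N₁, geomBound ((M₁ - M₀ : ℕ) : ℝ)
        ((((h₀ + h₁ : ℤ) : ℝ) * n + (h₁ : ℝ) * r) / (k ^ μ₂ : ℕ)) := by
  rw [phaseNM, filter_add_lt_eq_Ico]
  refine (norm_sum_le _ _).trans (sum_le_sum fun n _ => ?_)
  -- for fixed `n` the summand is `e(m yₙ) · (unimodular constant)`
  set y : ℝ := (((h₀ + h₁ : ℤ) : ℝ) * n + (h₁ : ℝ) * r) / (k ^ μ₂ : ℕ) with hy
  set C : ℂ := (𝐞 (((s * k ^ (μ₁ - μ₀) * (n + r) : ℕ) : ℝ) * ((h₁ : ℝ) + h₃) / (k ^ (μ₂ - μ₀) : ℕ)) : ℂ) *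
    (𝐞 (-(((s * k ^ (μ₁ - μ₀) * n : ℕ) : ℝ) * h₂ / (k ^ (μ₂ - μ₀) : ℕ))) : ℂ) with hC
  have hC1 : ‖C‖ = 1 := by rw [hC, norm_mul, norm_fourierChar, norm_fourierChar, mul_one]
  have hterm : ∀ m : ℕ,
      (𝐞 ((((h₀ : ℝ) + h₁) * m * n + (h₁ : ℝ) * m * r) / (k ^ μ₂ : ℕ)) : ℂ) *
        ((𝐞 (((s * k ^ (μ₁ - μ₀) * (n + r) : ℕ) : ℝ) * ((h₁ : ℝ) + h₃) / (k ^ (μ₂ - μ₀) : ℕ)) : ℂ) *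
          (𝐞 (-(((s * k ^ (μ₁ - μ₀) * n : ℕ) : ℝ) * h₂ / (k ^ (μ₂ - μ₀) : ℕ))) : ℂ)) =
        (𝐞 ((m : ℝ) * y) : ℂ) * C := by
    intro m
    rw [hC]
    congr 2
    rw [hy]
    push_cast
    ring
  rw [sum_congr rfl fun m _ => hterm m, ← sum_mul, norm_mul, hC1, mul_one]
  refine norm_sum_Ico_fourierChar_le_geomBound' y ?_
  exact_mod_cast (show M₁ - s * k ^ μ₁ - M₀ ≤ M₁ - M₀ by omega)

/-- **Summing `n` first**: for `μ₀ ≤ μ₂` and `k ≥ 1`,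
`‖phaseNM(h₀,h₁,h₂,h₃)‖ ≤ ∑_{M₀≤m<M₁−sk^{μ₁}} min(N₁−N₀, 1/(2‖((h₀+h₁)m + sk^{μ₁}(h₁+h₃−h₂))/k^{μ₂}‖))`.
[cite: MauduitRivat2015, §6.4.2 (variant: the `n`-sum is geometric as well)] -/
theorem norm_phaseNM_le_n {k : ℕ} (hk : 0 < k) {μ₀ μ₂ : ℕ} (h02 : μ₀ ≤ μ₂)
    (μ₁ M₀ M₁ N₀ N₁ r s : ℕ) (h₀ h₁ : ℤ) (h₂ h₃ : ℕ) :
    ‖phaseNM k μ₀ μ₁ μ₂ M₀ M₁ N₀ N₁ r s h₀ h₁ h₂ h₃‖ ≤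
      ∑ m ∈ Ico M₀ (M₁ - s * k ^ μ₁), geomBound ((N₁ - N₀ : ℕ) : ℝ)
        ((((h₀ + h₁ : ℤ) : ℝ) * m +
          ((s * k ^ (μ₁ - μ₀) : ℕ) : ℝ) * (k ^ μ₀ : ℕ) * ((h₁ : ℝ) + h₃ - h₂)) / (k ^ μ₂ : ℕ)) := by
  have hK : (0 : ℝ) < (k ^ μ₂ : ℕ) := by positivity
  have hK' : (0 : ℝ) < (k ^ (μ₂ - μ₀) : ℕ) := by positivity
  have hpow : ((k ^ μ₂ : ℕ) : ℝ) = (k ^ (μ₂ - μ₀) : ℕ) * (k ^ μ₀ : ℕ) := by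
    rw [← Nat.cast_mul, ← pow_add, Nat.sub_add_cancel h02]
  rw [phaseNM, filter_add_lt_eq_Ico, sum_comm]
  refine (norm_sum_le _ _).trans (sum_le_sum fun m _ => ?_)
  set y : ℝ := ((((h₀ + h₁ : ℤ) : ℝ) * m +
    ((s * k ^ (μ₁ - μ₀) : ℕ) : ℝ) * (k ^ μ₀ : ℕ) * ((h₁ : ℝ) + h₃ - h₂)) / (k ^ μ₂ : ℕ)) with hy
  set C : ℂ := (𝐞 (((h₁ : ℝ) * m * r) / (k ^ μ₂ : ℕ)) : ℂ) *
    (𝐞 (((s * k ^ (μ₁ - μ₀) * r : ℕ) : ℝ) * ((h₁ : ℝ) + h₃) / (k ^ (μ₂ - μ₀) : ℕ)) : ℂ) with hC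
  have hC1 : ‖C‖ = 1 := by rw [hC, norm_mul, norm_fourierChar, norm_fourierChar, mul_one]
  have hterm : ∀ n : ℕ,
      (𝐞 ((((h₀ : ℝ) + h₁) * m * n + (h₁ : ℝ) * m * r) / (k ^ μ₂ : ℕ)) : ℂ) *
        ((𝐞 (((s * k ^ (μ₁ - μ₀) * (n + r) : ℕ) : ℝ) * ((h₁ : ℝ) + h₃) / (k ^ (μ₂ - μ₀) : ℕ)) : ℂ) *
          (𝐞 (-(((s * k ^ (μ₁ - μ₀) * n : ℕ) : ℝ) * h₂ / (k ^ (μ₂ - μ₀) : ℕ))) : ℂ)) =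
        (𝐞 ((n : ℝ) * y) : ℂ) * C := by
    intro n
    rw [hC]
    simp only [coe_fourierChar_mul]
    congr 2
    rw [hy, hpow]
    have hk0 : (k : ℝ) ≠ 0 := by exact_mod_cast hk.ne'
    push_cast
    field_simp
    ring
  rw [sum_congr rfl fun n _ => hterm n, ← sum_mul, norm_mul, hC1, mul_one]
  exact norm_sum_Ico_fourierChar_le_geomBound' y le_rfl

/-- **`m` first, summed over `n` (Lemma 4)**: for `h₀ + h₁ ≠ 0`, `|h₀ + h₁| ≤ A`, `k ≥ 1`,
`‖phaseNM‖ ≤ (N₁/k^{μ₂} + 1)(2A(M₁−M₀) + k^{μ₂}(1 + log k^{μ₂}))`.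
[cite: MauduitRivat2015, §6.4.2 (second to fourth displays)] -/
theorem norm_phaseNM_le_m' {k : ℕ} (hk : 0 < k) (μ₀ μ₁ μ₂ M₀ M₁ N₀ N₁ r s : ℕ) {h₀ h₁ : ℤ} {A : ℕ}
    (hne : h₀ + h₁ ≠ 0) (hA : (h₀ + h₁).natAbs ≤ A) (h₂ h₃ : ℕ) :
    ‖phaseNM k μ₀ μ₁ μ₂ M₀ M₁ N₀ N₁ r s h₀ h₁ h₂ h₃‖ ≤
      ((N₁ / k ^ μ₂ + 1 : ℕ) : ℝ) *
        (2 * A * ((M₁ - M₀ : ℕ) : ℝ) + (k ^ μ₂ : ℕ) * (1 + Real.log ((k ^ μ₂ : ℕ) : ℝ))) := by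
  have hK : 0 < k ^ μ₂ := by positivity
  refine (norm_phaseNM_le_m k μ₀ μ₁ μ₂ M₀ M₁ N₀ N₁ r s h₀ h₁ h₂ h₃).trans ?_
  refine (sum_Ico_geomBound_linear_le hK (h₀ + h₁) _ N₀ N₁ (Nat.cast_nonneg _)).trans ?_
  have hg : (Nat.gcd (h₀ + h₁).natAbs (k ^ μ₂) : ℝ) ≤ A := gcd_natAbs_le hne hA
  have hM : (0 : ℝ) ≤ ((M₁ - M₀ : ℕ) : ℝ) := Nat.cast_nonneg _
  gcongr

/-- **`n` first, summed over `m` (Lemma 4)**: for `h₀ + h₁ ≠ 0`, `|h₀ + h₁| ≤ A`, `μ₀ ≤ μ₂`, `k ≥ 1`,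
`‖phaseNM‖ ≤ (M₁/k^{μ₂} + 1)(2A(N₁−N₀) + k^{μ₂}(1 + log k^{μ₂}))`.
[cite: MauduitRivat2015, §6.4.2 (variant with `m` and `n` exchanged)] -/
theorem norm_phaseNM_le_n' {k : ℕ} (hk : 0 < k) {μ₀ μ₂ : ℕ} (h02 : μ₀ ≤ μ₂)
    (μ₁ M₀ M₁ N₀ N₁ r s : ℕ) {h₀ h₁ : ℤ} {A : ℕ}
    (hne : h₀ + h₁ ≠ 0) (hA : (h₀ + h₁).natAbs ≤ A) (h₂ h₃ : ℕ) :
    ‖phaseNM k μ₀ μ₁ μ₂ M₀ M₁ N₀ N₁ r s h₀ h₁ h₂ h₃‖ ≤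
      ((M₁ / k ^ μ₂ + 1 : ℕ) : ℝ) *
        (2 * A * ((N₁ - N₀ : ℕ) : ℝ) + (k ^ μ₂ : ℕ) * (1 + Real.log ((k ^ μ₂ : ℕ) : ℝ))) := by
  have hK : 0 < k ^ μ₂ := by positivity
  refine (norm_phaseNM_le_n hk h02 μ₁ M₀ M₁ N₀ N₁ r s h₀ h₁ h₂ h₃).trans ?_
  refine (sum_Ico_geomBound_linear_le hK (h₀ + h₁) _ M₀ _ (Nat.cast_nonneg _)).trans ?_
  have hg : (Nat.gcd (h₀ + h₁).natAbs (k ^ μ₂) : ℝ) ≤ A := gcd_natAbs_le hne hA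
  have hN : (0 : ℝ) ≤ ((N₁ - N₀ : ℕ) : ℝ) := Nat.cast_nonneg _
  have hP : (((M₁ - s * k ^ μ₁) / k ^ μ₂ + 1 : ℕ) : ℝ) ≤ ((M₁ / k ^ μ₂ + 1 : ℕ) : ℝ) := by
    exact_mod_cast Nat.succ_le_succ (Nat.div_le_div_right (Nat.sub_le _ _))
  have hB : (0 : ℝ) ≤ 2 * A * ((N₁ - N₀ : ℕ) : ℝ) + (k ^ μ₂ : ℕ) * (1 + Real.log ((k ^ μ₂ : ℕ) : ℝ)) := by
    have : (0 : ℝ) ≤ Real.log ((k ^ μ₂ : ℕ) : ℝ) := Real.log_natCast_nonneg _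
    positivity
  calc (((M₁ - s * k ^ μ₁) / k ^ μ₂ + 1 : ℕ) : ℝ) *
        (2 * (Nat.gcd (h₀ + h₁).natAbs (k ^ μ₂) : ℝ) * ((N₁ - N₀ : ℕ) : ℝ) +
          (k ^ μ₂ : ℕ) * (1 + Real.log ((k ^ μ₂ : ℕ) : ℝ)))
      ≤ (((M₁ - s * k ^ μ₁) / k ^ μ₂ + 1 : ℕ) : ℝ) *
        (2 * A * ((N₁ - N₀ : ℕ) : ℝ) + (k ^ μ₂ : ℕ) * (1 + Real.log ((k ^ μ₂ : ℕ) : ℝ))) := by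
        gcongr
    _ ≤ _ := mul_le_mul_of_nonneg_right hP hB

/-! ## The `(h₂, h₃)`-sums: Cauchy–Schwarz and Parseval -/

/-- **`∑_{h<K'} ‖ĝ(h)ᴴ ĝ(a+h)‖ ≤ d`** for every `a ∈ ℤ` (`K' = k^{μ₂−μ₀}`, `k ≥ 1`):
`‖ĝ(h)ᴴĝ(a+h)‖ ≤ ‖ĝ(h)‖‖ĝ(a+h)‖`, Cauchy–Schwarz, the shift `h ↦ a + h` is a bijection modulo the
period, and Parseval `∑_h ‖ĝ(h)‖² = d` ((81)). [cite: MauduitRivat2015, §6.4.2 ("by the Cauchy–Schwarz inequality and (81)")] -/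
theorem sum_norm_conjTranspose_mul_shift_le (U : G →* unitaryGroup d ℂ) (f : ℕ → G) {k : ℕ}
    (hk : 0 < k) (μ₀ μ₁ μ₂ : ℕ) (a : ℤ) :
    ∑ h ∈ range (k ^ (μ₂ - μ₀)),
        ‖(ghatR U f k μ₀ μ₁ μ₂ (h : ℝ))ᴴ * ghatR U f k μ₀ μ₁ μ₂ ((a : ℝ) + h)‖ ≤ Fintype.card d := by
  set K' := k ^ (μ₂ - μ₀) with hK'def
  have hK' : 0 < K' := by positivity
  have hK'Z : (0 : ℤ) < (K' : ℤ) := by exact_mod_cast hK'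
  have hpar : ∑ h ∈ range K', ‖ghatR U f k μ₀ μ₁ μ₂ (h : ℝ)‖ ^ 2 = Fintype.card d := by
    have h := sum_norm_sq_ghat U f hk μ₀ μ₁ μ₂
    simp only [ghat] at h
    simp only [ghatR]
    exact h
  -- the shift modulo the period
  set a₀ : ℕ := (a % K').toNat with ha₀
  have ha₀' : ((a₀ : ℕ) : ℤ) = a % K' := by
    rw [ha₀, Int.toNat_of_nonneg (Int.emod_nonneg _ hK'Z.ne')]
  have hshift : ∀ h : ℕ, ‖ghatR U f k μ₀ μ₁ μ₂ ((a : ℝ) + h)‖ =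
      ‖ghatR U f k μ₀ μ₁ μ₂ ((((h + a₀) % K' : ℕ) : ℝ))‖ := by
    intro h
    obtain ⟨q, hq⟩ : ∃ q : ℕ, (h + a₀) / K' = q := ⟨_, rfl⟩
    have hdm := Nat.mod_add_div (h + a₀) K'
    rw [hq] at hdm
    have hdiv := Int.emod_add_mul_ediv a (K' : ℤ)
    have e : (a : ℝ) + h = (((h + a₀) % K' : ℕ) : ℝ) + (K' : ℕ) * ((q : ℤ) + a / K' : ℤ) := by
      have h2 := congrArg (fun n : ℕ => (n : ℝ)) hdm
      have h3 := congrArg (fun n : ℤ => (n : ℝ)) hdiv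
      push_cast at h2 h3 ⊢
      have h4 : ((a₀ : ℕ) : ℝ) = ((a % K' : ℤ) : ℝ) := by exact_mod_cast ha₀'
      linarith
    rw [e, hK'def, ghatR_add_period]
  have hshift2 : ∑ h ∈ range K', ‖ghatR U f k μ₀ μ₁ μ₂ ((((h + a₀) % K' : ℕ) : ℝ))‖ ^ 2 =
      Fintype.card d := by
    have hs := sum_range_shift_mod K' (fun y : ℕ => ‖ghatR U f k μ₀ μ₁ μ₂ (y : ℝ)‖ ^ 2) a₀
    beta_reduce at hs
    rw [hs, hpar]
  calc ∑ h ∈ range K', ‖(ghatR U f k μ₀ μ₁ μ₂ (h : ℝ))ᴴ * ghatR U f k μ₀ μ₁ μ₂ ((a : ℝ) + h)‖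
      ≤ ∑ h ∈ range K', ‖ghatR U f k μ₀ μ₁ μ₂ (h : ℝ)‖ *
          ‖ghatR U f k μ₀ μ₁ μ₂ ((((h + a₀) % K' : ℕ) : ℝ))‖ := by
        refine sum_le_sum fun h _ => ?_
        rw [← hshift h]
        refine (Matrix.frobenius_norm_mul _ _).trans ?_
        rw [Matrix.frobenius_norm_conjTranspose]
    _ ≤ Real.sqrt (∑ h ∈ range K', ‖ghatR U f k μ₀ μ₁ μ₂ (h : ℝ)‖ ^ 2) *
          Real.sqrt (∑ h ∈ range K', ‖ghatR U f k μ₀ μ₁ μ₂ ((((h + a₀) % K' : ℕ) : ℝ))‖ ^ 2) :=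
        Real.sum_mul_le_sqrt_mul_sqrt _ _ _
    _ = Fintype.card d := by rw [hpar, hshift2, Real.mul_self_sqrt (Nat.cast_nonneg _)]

/-! ## The weights: `∑_{|h|<H} |â(h)|` -/

/-- **`∑_{|h|<H} |â(h)| ≤ L/K + 1 + log H`** for `2H ≤ K` (`K ≥ 1`): `|â(0)| ≤ L/K` and
`|â(±h)| ≤ 1/(2h)` for `0 < h < H`. [cite: MauduitRivat2015, §6.4.2 (last display p. 2621) with (15)] -/
theorem sum_norm_ahat_le {K : ℕ} (hK : 0 < K) (L : ℕ) {Hs : ℕ} (h2 : 2 * Hs ≤ K) :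
    ∑ h ∈ Ioo (-(Hs : ℤ)) Hs, ‖ahat K L Hs h‖ ≤ (L : ℝ) / K + (1 + Real.log Hs) := by
  rcases Nat.eq_zero_or_pos Hs with hH | hH
  · subst hH
    simp only [Nat.cast_zero, neg_zero, Ioo_self, sum_empty, Real.log_zero, add_zero]
    positivity
  rw [sum_Ioo_neg_eq (fun h => ‖ahat K L Hs h‖) hH]
  have h0 : ‖ahat K L Hs 0‖ ≤ (L : ℝ) / K := norm_ahat_le_div hK L Hs 0
  have hpair : ∀ h ∈ Ico 1 Hs, ‖ahat K L Hs (h : ℤ)‖ + ‖ahat K L Hs (-(h : ℤ))‖ ≤ (h : ℝ)⁻¹ := by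
    intro h hh
    rw [mem_Ico] at hh
    have hne : (h : ℤ) ≠ 0 := by omega
    have habs : 2 * (h : ℤ).natAbs ≤ K := by rw [Int.natAbs_natCast]; omega
    have h1 := norm_ahat_le_inv_abs (K := K) L Hs hne habs
    have h2' := norm_ahat_le_inv_abs (K := K) L Hs (neg_ne_zero.2 hne) (by rwa [Int.natAbs_neg])
    rw [Int.cast_neg, abs_neg] at h2'
    have hpos : (0 : ℝ) < ((h : ℤ) : ℝ) := by exact_mod_cast hh.1
    rw [abs_of_pos hpos, Int.cast_natCast] at h1 h2'
    have hpos' : (0 : ℝ) < (h : ℝ) := by exact_mod_cast hh.1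
    calc ‖ahat K L Hs h‖ + ‖ahat K L Hs (-(h : ℤ))‖ ≤ 1 / (2 * (h : ℝ)) + 1 / (2 * (h : ℝ)) :=
          add_le_add h1 h2'
      _ = (h : ℝ)⁻¹ := by field_simp; ring
  have hsum : ∑ h ∈ Ico 1 Hs, (h : ℝ)⁻¹ ≤ 1 + Real.log Hs := sum_Ico_inv_le_log Hs
  linarith [sum_le_sum hpair]

/-! ## The skeleton of (85) -/

/-- **`|innerH(h₀,h₁)| ≤ d² · P`** whenever `‖phaseNM(h₀,h₁,h₂,h₃)‖ ≤ P` for all `h₂, h₃ < K'`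
(`|tr(XY)| ≤ ‖X‖‖Y‖` and `sum_norm_conjTranspose_mul_shift_le` twice).
[cite: MauduitRivat2015, §6.4.2] [cite: Mullner2017, §5.4.2] -/
theorem norm_innerH_le_of_phase_bound (U : G →* unitaryGroup d ℂ) (f : ℕ → G) {k : ℕ} (hk : 0 < k)
    (μ₀ μ₁ μ₂ M₀ M₁ N₀ N₁ r s : ℕ) (h₀ h₁ : ℤ) {P : ℝ} (hP0 : 0 ≤ P)
    (hP : ∀ h₂ h₃ : ℕ, ‖phaseNM k μ₀ μ₁ μ₂ M₀ M₁ N₀ N₁ r s h₀ h₁ h₂ h₃‖ ≤ P) :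
    ‖innerH U f k μ₀ μ₁ μ₂ M₀ M₁ N₀ N₁ r s h₀ h₁‖ ≤ (Fintype.card d : ℝ) ^ 2 * P := by
  set K' := k ^ (μ₂ - μ₀) with hK'
  set A : ℕ → Matrix d d ℂ := fun h₃ =>
    (ghatR U f k μ₀ μ₁ μ₂ (h₃ : ℝ))ᴴ * ghatR U f k μ₀ μ₁ μ₂ ((h₁ : ℝ) + h₃) with hA
  set B : ℕ → Matrix d d ℂ := fun h₂ =>
    (ghatR U f k μ₀ μ₁ μ₂ (h₂ : ℝ))ᴴ * ghatR U f k μ₀ μ₁ μ₂ ((h₀ : ℝ) + h₂) with hB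
  have hAsum : ∑ h₃ ∈ range K', ‖A h₃‖ ≤ Fintype.card d :=
    sum_norm_conjTranspose_mul_shift_le U f hk μ₀ μ₁ μ₂ h₁
  have hBsum : ∑ h₂ ∈ range K', ‖B h₂‖ ≤ Fintype.card d :=
    sum_norm_conjTranspose_mul_shift_le U f hk μ₀ μ₁ μ₂ h₀
  calc ‖innerH U f k μ₀ μ₁ μ₂ M₀ M₁ N₀ N₁ r s h₀ h₁‖
      ≤ ∑ h₂ ∈ range K', ∑ h₃ ∈ range K', (‖A h₃‖ * ‖B h₂‖) * P := by
        rw [innerH]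
        refine (norm_sum_le _ _).trans (sum_le_sum fun h₂ _ => (norm_sum_le _ _).trans
          (sum_le_sum fun h₃ _ => ?_))
        rw [norm_mul]
        refine mul_le_mul ?_ (hP h₂ h₃) (norm_nonneg _) (by positivity)
        exact norm_trace_mul_le (A h₃) (B h₂)
    _ = (∑ h₃ ∈ range K', ‖A h₃‖) * (∑ h₂ ∈ range K', ‖B h₂‖) * P := by
        rw [sum_mul, sum_mul, sum_comm]
        refine sum_congr rfl fun h₃ _ => ?_
        rw [mul_sum, sum_mul]
    _ ≤ (Fintype.card d : ℝ) * (Fintype.card d : ℝ) * P := by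
        have hA0 : 0 ≤ ∑ h₃ ∈ range K', ‖A h₃‖ := sum_nonneg fun _ _ => norm_nonneg _
        have hB0 : 0 ≤ ∑ h₂ ∈ range K', ‖B h₂‖ := sum_nonneg fun _ _ => norm_nonneg _
        exact mul_le_mul_of_nonneg_right (mul_le_mul hAsum hBsum hB0 (Nat.cast_nonneg _)) hP0
    _ = _ := by ring

/-- **`|S₄''(r,s)| ≤ K'² (L/K + 1 + log H)² d² · P`** whenever `‖phaseNM(h₀,h₁,·,·)‖ ≤ P` for all
off-diagonal pairs `|h₀|, |h₁| < H`, `h₀ + h₁ ≠ 0` (`2H ≤ K = k^{μ₂}`, `L = k^{μ₀}`, `K' = k^{μ₂−μ₀}`).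
[cite: MauduitRivat2015, §6.4.2, (85)] -/
theorem norm_corrS4rOff_le_of_phase_bound (U : G →* unitaryGroup d ℂ) (f : ℕ → G) {k : ℕ}
    (hk : 0 < k) (μ₀ μ₁ μ₂ : ℕ) {Hs : ℕ} (hH : 2 * Hs ≤ k ^ μ₂) (M₀ M₁ N₀ N₁ r s : ℕ) {P : ℝ}
    (hP0 : 0 ≤ P)
    (hP : ∀ h₀ h₁ : ℤ, h₀ ∈ Ioo (-(Hs : ℤ)) Hs → h₁ ∈ Ioo (-(Hs : ℤ)) Hs → h₀ + h₁ ≠ 0 →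
      ∀ h₂ h₃ : ℕ, ‖phaseNM k μ₀ μ₁ μ₂ M₀ M₁ N₀ N₁ r s h₀ h₁ h₂ h₃‖ ≤ P) :
    ‖corrS4rOff U f k μ₀ μ₁ μ₂ Hs M₀ M₁ N₀ N₁ r s‖ ≤
      (((k ^ (μ₂ - μ₀) : ℕ) : ℝ) * (k ^ (μ₂ - μ₀) : ℕ)) *
        (((k ^ μ₀ : ℕ) : ℝ) / (k ^ μ₂ : ℕ) + (1 + Real.log Hs)) ^ 2 *
          ((Fintype.card d : ℝ) ^ 2 * P) := by
  have hK : 0 < k ^ μ₂ := by positivity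
  set SA : ℝ := ((k ^ μ₀ : ℕ) : ℝ) / (k ^ μ₂ : ℕ) + (1 + Real.log Hs) with hSA
  have hSAb : ∑ h ∈ Ioo (-(Hs : ℤ)) Hs, ‖ahat (k ^ μ₂) (k ^ μ₀) Hs h‖ ≤ SA :=
    sum_norm_ahat_le hK (k ^ μ₀) hH
  set Q : ℝ := (Fintype.card d : ℝ) ^ 2 * P with hQ
  have hQ0 : 0 ≤ Q := by positivity
  have hmain : ‖∑ h₀ ∈ Ioo (-(Hs : ℤ)) Hs, ∑ h₁ ∈ (Ioo (-(Hs : ℤ)) Hs).filter (fun h₁ => h₀ + h₁ ≠ 0),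
          ahat (k ^ μ₂) (k ^ μ₀) Hs h₀ * ahat (k ^ μ₂) (k ^ μ₀) Hs h₁ *
            innerH U f k μ₀ μ₁ μ₂ M₀ M₁ N₀ N₁ r s h₀ h₁‖ ≤ SA ^ 2 * Q := by
    calc ‖∑ h₀ ∈ Ioo (-(Hs : ℤ)) Hs, ∑ h₁ ∈ (Ioo (-(Hs : ℤ)) Hs).filter (fun h₁ => h₀ + h₁ ≠ 0),
            ahat (k ^ μ₂) (k ^ μ₀) Hs h₀ * ahat (k ^ μ₂) (k ^ μ₀) Hs h₁ *
              innerH U f k μ₀ μ₁ μ₂ M₀ M₁ N₀ N₁ r s h₀ h₁‖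
        ≤ ∑ h₀ ∈ Ioo (-(Hs : ℤ)) Hs, ∑ h₁ ∈ (Ioo (-(Hs : ℤ)) Hs).filter (fun h₁ => h₀ + h₁ ≠ 0),
            ‖ahat (k ^ μ₂) (k ^ μ₀) Hs h₀‖ * ‖ahat (k ^ μ₂) (k ^ μ₀) Hs h₁‖ * Q := by
          refine (norm_sum_le _ _).trans (sum_le_sum fun h₀ hh₀ => (norm_sum_le _ _).trans
            (sum_le_sum fun h₁ hh₁ => ?_))
          rw [mem_filter] at hh₁
          rw [norm_mul, norm_mul]
          refine mul_le_mul_of_nonneg_left ?_ (by positivity)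
          exact norm_innerH_le_of_phase_bound U f hk μ₀ μ₁ μ₂ M₀ M₁ N₀ N₁ r s h₀ h₁ hP0
            (hP h₀ h₁ hh₀ hh₁.1 hh₁.2)
      _ ≤ ∑ h₀ ∈ Ioo (-(Hs : ℤ)) Hs, ∑ h₁ ∈ Ioo (-(Hs : ℤ)) Hs,
            ‖ahat (k ^ μ₂) (k ^ μ₀) Hs h₀‖ * ‖ahat (k ^ μ₂) (k ^ μ₀) Hs h₁‖ * Q := by
          refine sum_le_sum fun h₀ _ => ?_
          exact sum_le_sum_of_subset_of_nonneg (filter_subset _ _) fun h₁ _ _ => by positivity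
      _ = (∑ h₀ ∈ Ioo (-(Hs : ℤ)) Hs, ‖ahat (k ^ μ₂) (k ^ μ₀) Hs h₀‖) *
            (∑ h₁ ∈ Ioo (-(Hs : ℤ)) Hs, ‖ahat (k ^ μ₂) (k ^ μ₀) Hs h₁‖) * Q := by
          rw [sum_mul, sum_mul]
          refine sum_congr rfl fun h₀ _ => ?_
          rw [mul_sum, sum_mul]
      _ ≤ SA * SA * Q := by
          have h0 : 0 ≤ ∑ h₁ ∈ Ioo (-(Hs : ℤ)) Hs, ‖ahat (k ^ μ₂) (k ^ μ₀) Hs h₁‖ :=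
            sum_nonneg fun _ _ => norm_nonneg _
          exact mul_le_mul_of_nonneg_right (mul_le_mul hSAb hSAb h0 (h0.trans hSAb)) hQ0
      _ = SA ^ 2 * Q := by ring
  rw [corrS4rOff, norm_mul, norm_mul, Complex.norm_natCast]
  calc (((k ^ (μ₂ - μ₀) : ℕ) : ℝ) * ((k ^ (μ₂ - μ₀) : ℕ) : ℝ)) *
        ‖∑ h₀ ∈ Ioo (-(Hs : ℤ)) Hs, ∑ h₁ ∈ (Ioo (-(Hs : ℤ)) Hs).filter (fun h₁ => h₀ + h₁ ≠ 0),
          ahat (k ^ μ₂) (k ^ μ₀) Hs h₀ * ahat (k ^ μ₂) (k ^ μ₀) Hs h₁ *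
            innerH U f k μ₀ μ₁ μ₂ M₀ M₁ N₀ N₁ r s h₀ h₁‖
      ≤ (((k ^ (μ₂ - μ₀) : ℕ) : ℝ) * ((k ^ (μ₂ - μ₀) : ℕ) : ℝ)) * (SA ^ 2 * Q) :=
        mul_le_mul_of_nonneg_left hmain (by positivity)
    _ = _ := by ring

/-! ## (85) in both orientations -/

/-- **Mauduit–Rivat (85), `m` summed first (as printed)**: for `k ≥ 1`, `2H ≤ k^{μ₂}`,
`|S₄''(r,s)| ≤ K'² (L/K + 1 + log H)² d² (N₁/K + 1)(4H(M₁−M₀) + K(1 + log K))`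
(`K = k^{μ₂}`, `L = k^{μ₀}`, `K' = k^{μ₂−μ₀}`; MR: `≪ (log q)²ρ² q^{2(μ₂−μ₀)} ⌈q^ν/q^{μ₂}⌉ H q^{μ} log q^{μ₂}`).
[cite: MauduitRivat2015, §6.4.2, (85)] [cite: Mullner2017, §5.4.2] -/
theorem norm_corrS4rOff_le_m (U : G →* unitaryGroup d ℂ) (f : ℕ → G) {k : ℕ} (hk : 0 < k)
    (μ₀ μ₁ μ₂ : ℕ) {Hs : ℕ} (hH : 2 * Hs ≤ k ^ μ₂) (M₀ M₁ N₀ N₁ r s : ℕ) :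
    ‖corrS4rOff U f k μ₀ μ₁ μ₂ Hs M₀ M₁ N₀ N₁ r s‖ ≤
      (((k ^ (μ₂ - μ₀) : ℕ) : ℝ) * (k ^ (μ₂ - μ₀) : ℕ)) *
        (((k ^ μ₀ : ℕ) : ℝ) / (k ^ μ₂ : ℕ) + (1 + Real.log Hs)) ^ 2 *
          ((Fintype.card d : ℝ) ^ 2 * (((N₁ / k ^ μ₂ + 1 : ℕ) : ℝ) *
            (2 * ((2 * Hs : ℕ) : ℝ) * ((M₁ - M₀ : ℕ) : ℝ) +
              (k ^ μ₂ : ℕ) * (1 + Real.log ((k ^ μ₂ : ℕ) : ℝ))))) := by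
  refine norm_corrS4rOff_le_of_phase_bound U f hk μ₀ μ₁ μ₂ hH M₀ M₁ N₀ N₁ r s ?_ ?_
  · have : (0 : ℝ) ≤ Real.log ((k ^ μ₂ : ℕ) : ℝ) := Real.log_natCast_nonneg _
    positivity
  · intro h₀ h₁ hh₀ hh₁ hne h₂ h₃
    refine norm_phaseNM_le_m' hk μ₀ μ₁ μ₂ M₀ M₁ N₀ N₁ r s hne ?_ h₂ h₃
    rw [mem_Ioo] at hh₀ hh₁
    omega

/-- **Mauduit–Rivat (85), `n` summed first**: for `k ≥ 1`, `μ₀ ≤ μ₂`, `2H ≤ k^{μ₂}`,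
`|S₄''(r,s)| ≤ K'² (L/K + 1 + log H)² d² (M₁/K + 1)(4H(N₁−N₀) + K(1 + log K))`.
[cite: MauduitRivat2015, §6.4.2, (85) (roles of `m`, `n` exchanged)] [cite: Mullner2017, §5.4.2] -/
theorem norm_corrS4rOff_le_n (U : G →* unitaryGroup d ℂ) (f : ℕ → G) {k : ℕ} (hk : 0 < k)
    {μ₀ μ₂ : ℕ} (h02 : μ₀ ≤ μ₂) (μ₁ : ℕ) {Hs : ℕ} (hH : 2 * Hs ≤ k ^ μ₂)
    (M₀ M₁ N₀ N₁ r s : ℕ) :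
    ‖corrS4rOff U f k μ₀ μ₁ μ₂ Hs M₀ M₁ N₀ N₁ r s‖ ≤
      (((k ^ (μ₂ - μ₀) : ℕ) : ℝ) * (k ^ (μ₂ - μ₀) : ℕ)) *
        (((k ^ μ₀ : ℕ) : ℝ) / (k ^ μ₂ : ℕ) + (1 + Real.log Hs)) ^ 2 *
          ((Fintype.card d : ℝ) ^ 2 * (((M₁ / k ^ μ₂ + 1 : ℕ) : ℝ) *
            (2 * ((2 * Hs : ℕ) : ℝ) * ((N₁ - N₀ : ℕ) : ℝ) +
              (k ^ μ₂ : ℕ) * (1 + Real.log ((k ^ μ₂ : ℕ) : ℝ))))) := by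
  refine norm_corrS4rOff_le_of_phase_bound U f hk μ₀ μ₁ μ₂ hH M₀ M₁ N₀ N₁ r s ?_ ?_
  · have : (0 : ℝ) ≤ Real.log ((k ^ μ₂ : ℕ) : ℝ) := Real.log_natCast_nonneg _
    positivity
  · intro h₀ h₁ hh₀ hh₁ hne h₂ h₃
    refine norm_phaseNM_le_n' hk h02 μ₁ M₀ M₁ N₀ N₁ r s hne ?_ h₂ h₃
    rw [mem_Ioo] at hh₀ hh₁
    omega

end Literature.NumberTheory.LFunctions.MauduitRivat
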